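import Summits.HubbardSuperconductivity.HubbardLadder.Bounds.FugacityCentringWindow
import HarnessLib

/-!
# The tilted variance from a Cauchy estimate (bounds.tex Lemma 13.4, complex-analytic part)

HONEST FRAMING (cell pub-hubbard): ladder R1–R4 with certified numbers; no claim on H/H₀. Bounds
for model classes, no materials claim. This file is MODEL-FREE (Mathlib + part F8b
`FugacityCentringWindow` of LEAN FILING REQUEST #211 only).

Part F8d of the kernel device for bounds.tex Theorem 13 (N-sector form). Part F8c
(`SectorTwistRatio`) reduces Theorem 13_N to two analytic inputs; the first is the VARIANCE bound
`gcVar w n s ≤ V` for the tilted law `k ↦ e^{sk} w_k / Z(s)` of positive weights `w_0, …, w_n`;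
here that bound is reduced to the existence of an analytic logarithm with controlled
oscillation:

* the complex tilted power sums `F_j(ζ) = Σ_{k ≤ n} k^j e^{ζk} w_k` (`gcPowSumC`), entire, with
  `F_j' = F_{j+1}` and `F_j(s) = Σ k^j e^{sk} w_k` real at real `s`;
* the variance formula `Var(s) = F_2(s)/F_0(s) - (F_1(s)/F_0(s))²` (`gcVar_eq_gcPowSum`);
* **the Cauchy-estimate variance bound** (`gcVar_le_of_exp_eq`): if `g` is
  complex-differentiable on the ball `B(s, R₁)`, `exp ∘ g = F_0` there, and `‖g(ζ) - g(s)‖ ≤ C`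
  on the circle `|ζ - s| = R` (`0 < R < R₁`), then `Var(s) ≤ 2C/R²` — because `g' = F_1/F_0`
  (differentiate `e^{g} = F_0`; no identification of the branch is needed), so
  `g''(s) = Var(s)`, and Cauchy's estimate bounds `|g''(s)| ≤ 2!·C/R²`.

In the model (successor part) `g(ζ) = |Λ_L| log z(ζ) + log Ξ(ρ^{ζ/β}_0)` with the
Kotecký–Preiss logarithm, `C = |Λ_L| c_z + 2 a L²`, `R` of order one: `Var(s) ≤ v L²`.

References: bounds.tex §13 (Lemma 13.4); D. Ruelle, Statistical Mechanics (1969) §3.4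
[Ruelle1969]; R. Kotecký, D. Preiss, Comm. Math. Phys. 103 (1986) 491 [KoteckyPreiss1986].
-/

noncomputable section

namespace Summit.HubbardSuperconductivity.HubbardLadder.Bounds

open Finset Complex Metric

/-! ### Complex tilted power sums -/

/-- The complex tilted power sum `F_j(ζ) = Σ_{k ≤ n} k^j e^{ζ k} w_k`.
[programme definition: bounds.tex §13, Lemma 13.4] -/
def gcPowSumC (j : ℕ) (w : ℕ → ℝ) (n : ℕ) (ζ : ℂ) : ℂ :=
  ∑ k ∈ range (n + 1), ((k : ℂ) ^ j * (cexp (ζ * k) * (w k : ℂ)))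

/-- The real tilted power sum `Σ_{k ≤ n} k^j e^{s k} w_k`.
[programme definition: bounds.tex §13, Lemma 13.4] -/
def gcPowSum (j : ℕ) (w : ℕ → ℝ) (n : ℕ) (s : ℝ) : ℝ :=
  ∑ k ∈ range (n + 1), (((k : ℕ) : ℝ) ^ j * (Real.exp (s * k) * w k))

/-- At a real point the complex power sum is the real one. [this file] -/
theorem gcPowSumC_ofReal (j : ℕ) (w : ℕ → ℝ) (n : ℕ) (s : ℝ) :
    gcPowSumC j w n (s : ℂ) = ((gcPowSum j w n s : ℝ) : ℂ) := by
  unfold gcPowSumC gcPowSum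
  push_cast
  rfl

/-- `Σ k^0 e^{sk} w_k = Z(s)`. [this file] -/
theorem gcPowSum_zero (w : ℕ → ℝ) (n : ℕ) (s : ℝ) : gcPowSum 0 w n s = gcSum w n s := by
  simp [gcPowSum, gcSum]

/-- `Σ k^1 e^{sk} w_k` is the first moment. [this file] -/
theorem gcPowSum_one (w : ℕ → ℝ) (n : ℕ) (s : ℝ) : gcPowSum 1 w n s = gcMoment w n s := by
  simp [gcPowSum, gcMoment]

/-- `F_j' = F_{j+1}`. [this file] -/
theorem hasDerivAt_gcPowSumC (j : ℕ) (w : ℕ → ℝ) (n : ℕ) (ζ : ℂ) :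
    HasDerivAt (gcPowSumC j w n) (gcPowSumC (j + 1) w n ζ) ζ := by
  unfold gcPowSumC
  have h : ∀ k ∈ range (n + 1),
      HasDerivAt (fun ζ : ℂ => (k : ℂ) ^ j * (cexp (ζ * k) * (w k : ℂ)))
        ((k : ℂ) ^ (j + 1) * (cexp (ζ * k) * (w k : ℂ))) ζ := by
    intro k _
    have h1 : HasDerivAt (fun ζ : ℂ => ζ * k) (k : ℂ) ζ := by
      simpa using (hasDerivAt_id ζ).mul_const (k : ℂ)
    exact ((h1.cexp.mul_const (w k : ℂ)).const_mul ((k : ℂ) ^ j)).congr_deriv (by ring)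
  exact HasDerivAt.fun_sum h

/-- The complex power sums are entire. [this file] -/
theorem differentiable_gcPowSumC (j : ℕ) (w : ℕ → ℝ) (n : ℕ) :
    Differentiable ℂ (gcPowSumC j w n) :=
  fun ζ => (hasDerivAt_gcPowSumC j w n ζ).differentiableAt

/-! ### The variance formula -/

/-- `Var(s) = (F_2(s) Z(s) - F_1(s)²) / Z(s)²`. [folklore; this file] -/
theorem gcVar_eq_gcPowSum {w : ℕ → ℝ} {n : ℕ} (hw : ∀ k ≤ n, 0 < w k) (s : ℝ) :
    gcVar w n s = (gcPowSum 2 w n s * gcSum w n s - gcMoment w n s ^ 2) / gcSum w n s ^ 2 := by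
  have hZ : gcSum w n s ≠ 0 := (gcSum_pos hw s).ne'
  have hm : gcMean w n s = gcMoment w n s / gcSum w n s := rfl
  unfold gcVar
  set m := gcMean w n s with hm'
  have h1 : ∀ k ∈ range (n + 1), (((k : ℕ) : ℝ) - m) ^ 2 * (Real.exp (s * k) * w k) =
      ((k : ℕ) : ℝ) ^ 2 * (Real.exp (s * k) * w k)
        - 2 * m * (((k : ℕ) : ℝ) * (Real.exp (s * k) * w k))
        + m ^ 2 * (Real.exp (s * k) * w k) := fun k _ => by ring
  rw [Finset.sum_congr rfl h1, Finset.sum_add_distrib, Finset.sum_sub_distrib, ← Finset.mul_sum,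
    ← Finset.mul_sum]
  have e2 : ∑ k ∈ range (n + 1), ((k : ℕ) : ℝ) ^ 2 * (Real.exp (s * k) * w k) =
      gcPowSum 2 w n s := rfl
  have e1 : ∑ k ∈ range (n + 1), ((k : ℕ) : ℝ) * (Real.exp (s * k) * w k) =
      gcMoment w n s := rfl
  have e0 : ∑ k ∈ range (n + 1), Real.exp (s * k) * w k = gcSum w n s := rfl
  rw [e2, e1, e0, hm]
  field_simp
  ring

/-! ### The Cauchy-estimate variance bound -/

/-- **The logarithmic derivative**: if `g` is differentiable on the ball `B(c, R₁)` and
`e^{g} = F_0` there, then `g' = F_1 / F_0` on the ball. [folklore; this file] -/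
theorem deriv_eq_gcPowSumC_div {w : ℕ → ℝ} {n : ℕ} {c : ℂ} {R₁ : ℝ} {g : ℂ → ℂ}
    (hg : DifferentiableOn ℂ g (ball c R₁))
    (hexp : ∀ ζ ∈ ball c R₁, cexp (g ζ) = gcPowSumC 0 w n ζ) {ζ : ℂ}
    (hζ : ζ ∈ ball c R₁) : deriv g ζ = gcPowSumC 1 w n ζ / gcPowSumC 0 w n ζ := by
  have hne : gcPowSumC 0 w n ζ ≠ 0 := by rw [← hexp ζ hζ]; exact Complex.exp_ne_zero _
  have hgd : HasDerivAt g (deriv g ζ) ζ :=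
    (hg.differentiableAt (isOpen_ball.mem_nhds hζ)).hasDerivAt
  have h1 : HasDerivAt (fun ζ => cexp (g ζ)) (cexp (g ζ) * deriv g ζ) ζ := hgd.cexp
  have h2 : HasDerivAt (gcPowSumC 0 w n) (cexp (g ζ) * deriv g ζ) ζ :=
    h1.congr_of_eventuallyEq (Filter.eventuallyEq_of_mem (isOpen_ball.mem_nhds hζ)
      fun z hz => (hexp z hz).symm)
  have h3 : cexp (g ζ) * deriv g ζ = gcPowSumC 1 w n ζ :=
    h2.unique (hasDerivAt_gcPowSumC 0 w n ζ)
  rw [hexp ζ hζ] at h3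
  rw [eq_div_iff hne, mul_comm]
  exact h3

/-- **The second logarithmic derivative is the variance**: if `g` is differentiable on
`B(s, R₁)` (`R₁ > 0`) with `e^{g} = F_0` there, then `g''(s) = Var(s)`. [folklore; this file] -/
theorem deriv_deriv_eq_gcVar {w : ℕ → ℝ} {n : ℕ} (hw : ∀ k ≤ n, 0 < w k) (s : ℝ) {R₁ : ℝ}
    (hR₁ : 0 < R₁) {g : ℂ → ℂ} (hg : DifferentiableOn ℂ g (ball (s : ℂ) R₁))
    (hexp : ∀ ζ ∈ ball (s : ℂ) R₁, cexp (g ζ) = gcPowSumC 0 w n ζ) :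
    deriv (deriv g) (s : ℂ) = ((gcVar w n s : ℝ) : ℂ) := by
  have hs : (s : ℂ) ∈ ball (s : ℂ) R₁ := mem_ball_self hR₁
  have hne : gcPowSumC 0 w n (s : ℂ) ≠ 0 := by rw [← hexp _ hs]; exact Complex.exp_ne_zero _
  have hderiv2 : deriv (deriv g) (s : ℂ) =
      (gcPowSumC 2 w n s * gcPowSumC 0 w n s - gcPowSumC 1 w n s * gcPowSumC 1 w n s) /
        gcPowSumC 0 w n s ^ 2 := by
    have heq : deriv g =ᶠ[nhds (s : ℂ)] fun ζ => gcPowSumC 1 w n ζ / gcPowSumC 0 w n ζ :=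
      Filter.eventuallyEq_of_mem (isOpen_ball.mem_nhds hs)
        fun ζ hζ => deriv_eq_gcPowSumC_div hg hexp hζ
    rw [heq.deriv_eq]
    exact ((hasDerivAt_gcPowSumC 1 w n (s : ℂ)).fun_div (hasDerivAt_gcPowSumC 0 w n (s : ℂ))
      hne).deriv
  rw [hderiv2, gcVar_eq_gcPowSum hw s, ← gcPowSum_zero, ← gcPowSum_one, gcPowSumC_ofReal,
    gcPowSumC_ofReal, gcPowSumC_ofReal]
  push_cast
  ring

/-- **Cauchy's estimate for the second derivative, oscillation form**: if `g` is differentiable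
on `B(c, R₁)` and `‖g(ζ) - g(c)‖ ≤ C` on the circle `|ζ - c| = R` (`0 < R < R₁`), then
`‖g''(c)‖ ≤ 2C/R²`. [folklore: Cauchy's estimate; this file] -/
theorem norm_deriv_deriv_le_of_sphere {c : ℂ} {R R₁ C : ℝ} (hR : 0 < R) (hRR₁ : R < R₁)
    {g : ℂ → ℂ} (hg : DifferentiableOn ℂ g (ball c R₁))
    (hC : ∀ ζ ∈ sphere c R, ‖g ζ - g c‖ ≤ C) :
    ‖deriv (deriv g) c‖ ≤ 2 * C / R ^ 2 := by
  have hider : iteratedDeriv 2 (fun ζ => g ζ - g c) c = deriv (deriv g) c := by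
    rw [show (2 : ℕ) = 1 + 1 from rfl, iteratedDeriv_succ, iteratedDeriv_one]
    have : deriv (fun ζ => g ζ - g c) = deriv g := by
      funext ζ; exact deriv_sub_const (g c)
    rw [this]
  have hdc : DiffContOnCl ℂ (fun ζ => g ζ - g c) (ball c R) := by
    have hsub : closure (ball c R) ⊆ ball c R₁ :=
      closure_ball_subset_closedBall.trans (closedBall_subset_ball hRR₁)
    exact ((hg.sub_const (g c)).mono hsub).diffContOnCl
  have hcau := Complex.norm_iteratedDeriv_le_of_forall_mem_sphere_norm_le 2 hR hdc hC
  rw [hider, Nat.factorial_two, Nat.cast_ofNat] at hcau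
  exact hcau

/-- **THEOREM (Cauchy-estimate variance bound; bounds.tex Lemma 13.4, analytic part).** Let
`w_0, …, w_n > 0`, `s` real, `0 < R < R₁`. If `g` is complex-differentiable on `B(s, R₁)` with
`e^{g(ζ)} = Σ_k e^{ζk} w_k` there and `‖g(ζ) - g(s)‖ ≤ C` on the circle `|ζ - s| = R`,
then `Var(s) ≤ 2C/R²`. [programme: bounds.tex §13, Lemma 13.4; this file] -/
theorem gcVar_le_of_exp_eq {w : ℕ → ℝ} {n : ℕ} (hw : ∀ k ≤ n, 0 < w k) (s : ℝ)
    {R R₁ C : ℝ} (hR : 0 < R) (hRR₁ : R < R₁) {g : ℂ → ℂ}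
    (hg : DifferentiableOn ℂ g (ball (s : ℂ) R₁))
    (hexp : ∀ ζ ∈ ball (s : ℂ) R₁, cexp (g ζ) = gcPowSumC 0 w n ζ)
    (hC : ∀ ζ ∈ sphere (s : ℂ) R, ‖g ζ - g s‖ ≤ C) :
    gcVar w n s ≤ 2 * C / R ^ 2 := by
  have h := norm_deriv_deriv_le_of_sphere hR hRR₁ hg hC
  rw [deriv_deriv_eq_gcVar hw s (hR.trans hRR₁) hg hexp, Complex.norm_real,
    Real.norm_eq_abs] at h
  exact (le_abs_self _).trans h

/-- **THEOREM (variance bound, split form; bounds.tex Lemma 13.4).** Let `w_0, …, w_n > 0`, `s`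
real, `0 < R < R₁`, and `g₁, g₂` complex-differentiable on `B(s, R₁)` with
`e^{g₁(ζ) + g₂(ζ)} = Σ_k e^{ζk} w_k` there. If `Re g₁''(s) ≤ D` and `‖g₂(ζ) - g₂(s)‖ ≤ C` on the
circle `|ζ - s| = R`, then `Var(s) ≤ D + 2C/R²`. (In the model `g₁ = |Λ| log z` is the atomic
part, handled on the real axis, and `g₂ = log Ξ` the Kotecký–Preiss logarithm, handled by Cauchy's
estimate.) [programme: bounds.tex §13, Lemma 13.4; this file] -/
theorem gcVar_le_of_exp_add_eq {w : ℕ → ℝ} {n : ℕ} (hw : ∀ k ≤ n, 0 < w k) (s : ℝ)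
    {R R₁ C D : ℝ} (hR : 0 < R) (hRR₁ : R < R₁) {g₁ g₂ : ℂ → ℂ}
    (hg₁ : DifferentiableOn ℂ g₁ (ball (s : ℂ) R₁)) (hg₂ : DifferentiableOn ℂ g₂ (ball (s : ℂ) R₁))
    (hexp : ∀ ζ ∈ ball (s : ℂ) R₁, cexp (g₁ ζ + g₂ ζ) = gcPowSumC 0 w n ζ)
    (hD : (deriv (deriv g₁) (s : ℂ)).re ≤ D)
    (hC : ∀ ζ ∈ sphere (s : ℂ) R, ‖g₂ ζ - g₂ s‖ ≤ C) :
    gcVar w n s ≤ D + 2 * C / R ^ 2 := by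
  have hR₁ : 0 < R₁ := hR.trans hRR₁
  have hs : (s : ℂ) ∈ ball (s : ℂ) R₁ := mem_ball_self hR₁
  have hnhds : ball (s : ℂ) R₁ ∈ nhds (s : ℂ) := isOpen_ball.mem_nhds hs
  -- the sum `g = g₁ + g₂`
  have hg : DifferentiableOn ℂ (fun ζ => g₁ ζ + g₂ ζ) (ball (s : ℂ) R₁) := hg₁.add hg₂
  have hvar := deriv_deriv_eq_gcVar hw s hR₁ hg hexp
  -- `g'' = g₁'' + g₂''` at `s`
  have hd₁ : DifferentiableAt ℂ (deriv g₁) (s : ℂ) :=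
    ((hg₁.analyticOnNhd isOpen_ball).deriv.differentiableOn.differentiableAt hnhds)
  have hd₂ : DifferentiableAt ℂ (deriv g₂) (s : ℂ) :=
    ((hg₂.analyticOnNhd isOpen_ball).deriv.differentiableOn.differentiableAt hnhds)
  have heq : deriv (fun ζ => g₁ ζ + g₂ ζ) =ᶠ[nhds (s : ℂ)] fun ζ => deriv g₁ ζ + deriv g₂ ζ := by
    filter_upwards [hnhds] with ζ hζ
    exact deriv_add (hg₁.differentiableAt (isOpen_ball.mem_nhds hζ))
      (hg₂.differentiableAt (isOpen_ball.mem_nhds hζ))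
  have hsum : deriv (deriv fun ζ => g₁ ζ + g₂ ζ) (s : ℂ) =
      deriv (deriv g₁) (s : ℂ) + deriv (deriv g₂) (s : ℂ) := by
    rw [heq.deriv_eq]
    exact deriv_add hd₁ hd₂
  -- real parts
  have h₂ := norm_deriv_deriv_le_of_sphere hR hRR₁ hg₂ hC
  have hre : gcVar w n s = (deriv (deriv g₁) (s : ℂ)).re + (deriv (deriv g₂) (s : ℂ)).re := by
    have := congrArg Complex.re hvar
    rw [hsum, Complex.add_re, Complex.ofReal_re] at this
    exact this.symm
  rw [hre]
  exact add_le_add hD ((le_abs_self _).trans ((Complex.abs_re_le_norm _).trans h₂))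

end Summit.HubbardSuperconductivity.HubbardLadder.Bounds

end
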